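import Mathlib

/-!
# The weight-0 Eisenstein series of `(Γ₀(N), χ)`, `χ` even, is invariant under `z ↦ -z̄`

Stub P3 `stub_eisenstein_even` of line `Sketch` (crux stmt-Langlands-15897,
`Summit.Langlands.Langlands.Theses.QuarterDeficit1951.QuarterFingerprintDeficit`), kernel-proved.

`E(z, s, χ) = Σ_{(c,d)=1, N ∣ c} χ(d)⁻¹ yˢ / |cz + d|^{2s}` (as a `tsum` over the index subtype; both signs of
`(c,d)`, no factor `1/2`) satisfies `E(R z, s, χ) = E(z, s, χ)` for `R z = -z̄` (`UpperHalfPlane.J • z`) whenever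
`χ(-1) = 1`: `|c(-z̄) + d| = |cz - d|`, `Im(R z) = Im z`, and the involution `(c, d) ↦ (c, -d)` of the index set
carries one summand to the other (`χ(-d) = χ(-1)χ(d) = χ(d)`). This is a pure reindexing (`Equiv.tsum_eq`), valid
for every real `s` with no summability hypothesis. It is the kernel-checkable heart of "the continuous spectrum of
`(Γ₀(p), χ)`, `χ` even, `p` prime, is `R`-even, so the odd sector is purely cuspidal".

The two auxiliary identities live in the sub-namespace `EisensteinEvenAux` (sibling stub files of the same line
declare into the same parent namespace); the reindexing equivalence is built inside the proof.
-/

set_option linter.dupNamespace false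

namespace Summit.Langlands.Langlands.Theorems.QuarterFingerprintDeficit

open scoped MatrixGroups ComplexConjugate
open UpperHalfPlane

namespace EisensteinEvenAux

/-- `Im (R z) = Im z` for `R z = -z̄`. [folklore] -/
theorem im_J_smul (z : ℍ) : (J • z).im = z.im := by
  rw [← coe_im, coe_J_smul]
  simp

/-- `|c (R z) + d| = |c z - d|` for real (here: integer) `c, d` and `R z = -z̄`. [folklore] -/
theorem norm_linear_J_smul (c d : ℤ) (z : ℍ) :
    ‖(c : ℂ) * ((↑(J • z)) : ℂ) + (d : ℂ)‖ = ‖(c : ℂ) * (z : ℂ) + ((-d : ℤ) : ℂ)‖ := by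
  rw [coe_J_smul]
  have e : (c : ℂ) * (-conj (z : ℂ)) + (d : ℂ) = -(conj ((c : ℂ) * (z : ℂ) + ((-d : ℤ) : ℂ))) := by
    simp only [map_add, map_mul, map_neg, map_intCast, Int.cast_neg]
    ring
  rw [e, norm_neg, Complex.norm_conj]

end EisensteinEvenAux

/-- **Stub P3 (proved).** For an even Dirichlet character the weight-0 Eisenstein `tsum` of `(Γ₀(N), χ)` at the
cusp `∞` is invariant under `R : z ↦ -z̄`. [folklore] -/
theorem stub_eisenstein_even (N : ℕ) (χ : DirichletCharacter ℂ N) (hχ : χ (-1) = 1) (s : ℝ)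
    (z : UpperHalfPlane) :
    (∑' v : {v : Fin 2 → ℤ // IsCoprime (v 0) (v 1) ∧ (N : ℤ) ∣ v 0},
      (χ ((v.1 1 : ℤ) : ZMod N))⁻¹ *
        (((UpperHalfPlane.im (UpperHalfPlane.J • z)) ^ s /
          ‖((v.1 0 : ℤ) : ℂ) * ((↑(UpperHalfPlane.J • z)) : ℂ) + ((v.1 1 : ℤ) : ℂ)‖ ^ (2 * s) : ℝ) : ℂ)) =
    ∑' v : {v : Fin 2 → ℤ // IsCoprime (v 0) (v 1) ∧ (N : ℤ) ∣ v 0},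
      (χ ((v.1 1 : ℤ) : ZMod N))⁻¹ *
        (((UpperHalfPlane.im z) ^ s / ‖((v.1 0 : ℤ) : ℂ) * (z : ℂ) + ((v.1 1 : ℤ) : ℂ)‖ ^ (2 * s) : ℝ) : ℂ) := by
  -- the involution `(c, d) ↦ (c, -d)` of the index set, as a self-equivalence `E`
  obtain ⟨E, hE0, hE1⟩ :
      ∃ E : {v : Fin 2 → ℤ // IsCoprime (v 0) (v 1) ∧ (N : ℤ) ∣ v 0} ≃
          {v : Fin 2 → ℤ // IsCoprime (v 0) (v 1) ∧ (N : ℤ) ∣ v 0},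
        (∀ v, (E v).1 0 = v.1 0) ∧ ∀ v, (E v).1 1 = -v.1 1 := by
    have hmem : ∀ v : {v : Fin 2 → ℤ // IsCoprime (v 0) (v 1) ∧ (N : ℤ) ∣ v 0},
        IsCoprime (![v.1 0, -v.1 1] 0) (![v.1 0, -v.1 1] 1) ∧ (N : ℤ) ∣ ![v.1 0, -v.1 1] 0 :=
      fun v => by simpa using And.intro v.2.1.neg_right v.2.2
    refine ⟨⟨fun v => ⟨![v.1 0, -v.1 1], hmem v⟩, fun v => ⟨![v.1 0, -v.1 1], hmem v⟩,
      fun v => ?_, fun v => ?_⟩, fun v => rfl, fun v => rfl⟩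
    all_goals
      apply Subtype.ext
      funext i
      fin_cases i <;> simp
  -- the right-hand summand as a function of the index
  set f : {v : Fin 2 → ℤ // IsCoprime (v 0) (v 1) ∧ (N : ℤ) ∣ v 0} → ℂ := fun v =>
    (χ ((v.1 1 : ℤ) : ZMod N))⁻¹ *
      (((UpperHalfPlane.im z) ^ s / ‖((v.1 0 : ℤ) : ℂ) * (z : ℂ) + ((v.1 1 : ℤ) : ℂ)‖ ^ (2 * s) : ℝ) : ℂ)
    with hf
  -- evenness: `χ(-d) = χ(-1) χ(d) = χ(d)`
  have hχneg : ∀ d : ℤ, χ (((-d : ℤ)) : ZMod N) = χ ((d : ℤ) : ZMod N) := by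
    intro d
    rw [Int.cast_neg, neg_eq_neg_one_mul, map_mul, hχ, one_mul]
  -- termwise: summand at `R z` and index `(c, d)` = summand at `z` and index `E (c, d) = (c, -d)`
  have hterm : ∀ v : {v : Fin 2 → ℤ // IsCoprime (v 0) (v 1) ∧ (N : ℤ) ∣ v 0},
      (χ ((v.1 1 : ℤ) : ZMod N))⁻¹ *
        (((UpperHalfPlane.im (UpperHalfPlane.J • z)) ^ s /
          ‖((v.1 0 : ℤ) : ℂ) * ((↑(UpperHalfPlane.J • z)) : ℂ) + ((v.1 1 : ℤ) : ℂ)‖ ^ (2 * s) : ℝ) : ℂ) =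
      f (E v) := by
    intro v
    simp only [hf, hE0, hE1]
    rw [EisensteinEvenAux.im_J_smul, EisensteinEvenAux.norm_linear_J_smul, hχneg]
  calc _ = ∑' v, f (E v) := tsum_congr hterm
    _ = ∑' v, f v := Equiv.tsum_eq E f

end Summit.Langlands.Langlands.Theorems.QuarterFingerprintDeficit
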